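import Summits.CriticalPhenomena.SAWScalingLimit.Theses.SAWRestrictionRigidity
import Summits.CriticalPhenomena.SAWScalingLimit.Theorems.SAWRestrictionRigidityRigidityNoLinearSymmetry
import Summits.CriticalPhenomena.SAWScalingLimit.Theorems.SAWRestrictionRigidityRigidityQuarterTurnDescent
import Summits.CriticalPhenomena.SAWScalingLimit.Theorems.SAWRestrictionRigidityRigidityCovarianceTransport
import Summits.CriticalPhenomena.SAWScalingLimit.Theorems.SAWRestrictionRigidityRigidityTransportAxioms

/-!
# Crux `Rigidity` (stmt-CriticalPhenomena-1368) modulo the linear-modulus theorem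

Line `registered` of crux `Rigidity` (route SAWRestrictionRigidity, shared with SAWZoomRigidity)
reduces the crux to ONE conjectural statement, the registered core stub `stub_linearModulusCore`
("the crux modulo a linear modulus": under the crux hypotheses verbatim, for some real-linear
automorphism `L` of the plane the transported family `S D = (L⁻¹)_* P (L D)` is conformally
covariant — implied by the crux with `L = id`; a proof may work GL₂(ℝ)-equivariantly and ignore the
rotations; open in print, LSW04 / Beffara 2008 Prop. 4). This file records the reduction as a
kernel-checked implication (so the crux and its core stub are EQUIVALENT over the tree)

  `rigidity_of_linearModulusCore : (core statement) → Rigidity`,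

assembled from the LANDED stubs of the line: `stub_transportAxioms` (the transport keeps
chordality / restriction / simplicity), `stub_noLinearSymmetry` (the conformally covariant
restriction family on simple curves — chordal SLE(8/3) by LSW03, a tree theorem — has no
non-(anti)conformal real-linear symmetry: stretch rigidity of SLE(8/3)),
`stub_quarterTurnDescent` (the quarter-turn of `P` descends to `M = L⁻¹ ∘ (i·) ∘ L`, `M² = −1`,
so `L` is complex-(anti)linear) and `stub_covarianceTransport` (conformal covariance transports
through a complex-(anti)linear `L`). The hypothesis is stated inline (it is the line's open stub,
not a published fact); nothing here is conditional on an unproved Literature fact.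

References: G. F. Lawler, O. Schramm, W. Werner, *Conformal restriction: the chordal case* (2003)
[LawlerSchrammWerner2003Restriction]; *On the scaling limit of planar self-avoiding walk* (2004),
§3.4.5 [LawlerSchrammWerner2004SAW]; V. Beffara, *Is critical 2D percolation universal?* (2008),
Prop. 4, §2.2 [Beffara2008Universal].
-/

namespace Summit.CriticalPhenomena.SAWScalingLimit.Cruxes.Rigidity.Birth

open MeasureTheory

/-- **`Rigidity` modulo the linear-modulus theorem.** If every chordal family with two-sided
restriction, the restriction-coupled domain Markov property, reversibility, covariance under the
lattice similarity group `z ↦ r·iᵏ·z + w` and under complex conjugation, carried by simple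
boundary-avoiding curves, is the real-linear image of a conformally covariant family (`S D = (L⁻¹)_* P (L D)` conformally
covariant for some `L : ℂ ≃L[ℝ] ℂ` — the registered core stub `stub_linearModulusCore` of line
`registered`), then the crux `Rigidity` of route SAWRestrictionRigidity holds: the quarter-turn of
the lattice similarity group pins the modulus (`stub_transportAxioms`, `stub_noLinearSymmetry`,
`stub_quarterTurnDescent`, `stub_covarianceTransport`, all landed). -/
theorem rigidity_of_linearModulusCore : (∀ P : Literature.Probability.RandomPlanarGeometry.ChordalFamily, P.IsChordal → P.IsRestriction → (∃ Q : Literature.Probability.RandomPlanarGeometry.DobrushinDomain → Literature.Probability.RandomPlanarGeometry.CurveClass ℂ → MeasureTheory.Measure (Literature.Probability.RandomPlanarGeometry.CurveClass ℂ), P.IsMarkovExtension Q ∧ ∀ (D : Literature.Probability.RandomPlanarGeometry.DobrushinDomain) (p : Literature.Probability.RandomPlanarGeometry.CurveClass ℂ) (D' : Literature.Probability.RandomPlanarGeometry.DobrushinDomain), D'.carrier ⊆ Literature.Probability.RandomPlanarGeometry.remainingDomain D p → D'.pt 0 = p.target → D'.pt 1 = D.pt 1 → ∀ T : Set (Literature.Probability.RandomPlanarGeometry.CurveClass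 ℂ), MeasurableSet T → P D' T * Q D p (Literature.Probability.RandomPlanarGeometry.CurveClass.rangeSubset (closure D'.carrier)) = Q D p (T ∩ Literature.Probability.RandomPlanarGeometry.CurveClass.rangeSubset (closure D'.carrier))) → (∀ D D' : Literature.Probability.RandomPlanarGeometry.DobrushinDomain, D'.carrier = D.carrier → D'.pt 0 = D.pt 1 → D'.pt 1 = D.pt 0 → P D' = (P D).map Literature.Probability.RandomPlanarGeometry.CurveClass.reverse) → (∀ (D : Literature.Probability.RandomPlanarGeometry.DobrushinDomain) (c : ℂ) (hc : c ≠ 0) (w : ℂ), (∃ (r : ℝ) (k : ℕ), 0 < r ∧ c = (r : ℂ) * Complex.I ^ k) → P (D.map (Literature.Probability.RandomPlanarGeometry.similarity c hc w)) = (P D).map (Literature.Probability.RandomPlanarGeometry.CurveClass.map (Literature.Probability.RandomPlanarGeometry.similarity c hc w : C(ℂ, ℂ)))) → (∀ D : Literature.Probability.RandomPlanarGeometry.DobrushinDomain, P (D.map Complex.conjLIE.toHomeomorph) = (P D).map (Literature.Probability.RandomPlanarGeometry.CurveClass.map (Complex.conjLIE.toHomeomorph : C(ℂ, ℂ)))) →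 (∀ D : Literature.Probability.RandomPlanarGeometry.DobrushinDomain, ∀ᵐ γ ∂(P D), γ ∈ Literature.Probability.RandomPlanarGeometry.CurveClass.simple ∧ γ.range ∩ frontier D.carrier ⊆ {D.pt 0, D.pt 1}) → ∃ (L : ℂ ≃L[ℝ] ℂ) (S : Literature.Probability.RandomPlanarGeometry.ChordalFamily), (∀ D : Literature.Probability.RandomPlanarGeometry.DobrushinDomain, S D = (P (D.map L.toHomeomorph)).map (Literature.Probability.RandomPlanarGeometry.CurveClass.map (L.symm.toHomeomorph : C(ℂ, ℂ)))) ∧ S.IsConformallyCovariant) → Summit.CriticalPhenomena.SAWScalingLimit.Theses.SAWRestrictionRigidity.Rigidity := by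
  intro hcore P hch hres hmk hrev hsim hconj hsimple
  -- stub 1: the linear modulus `L` and the conformally covariant transport `S`
  obtain ⟨L, S, hS, h0cc⟩ :=
    hcore P hch hres hmk hrev hsim hconj hsimple
  -- stub 1': the transported family keeps the other axioms
  obtain ⟨h0ch, h0res, h0simple⟩ := stub_transportAxioms P S L hS hch hres hsimple
  -- stub 3a pins the modulus, fed stub 2 (no hidden linear symmetry of `S`) and the quarter-turn of `P`
  have hL : (∃ c : ℂ, ∀ z : ℂ, L z = c * z) ∨ (∃ c : ℂ, ∀ z : ℂ, L z = c * (starRingEnd ℂ) z) :=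
    stub_quarterTurnDescent P S L hS hsim
      (fun M hM => stub_noLinearSymmetry S M h0ch h0cc h0res h0simple hM)
  -- stub 3b transports conformal covariance from `S` back to `P`
  exact stub_covarianceTransport P S L hS h0cc hL

end Summit.CriticalPhenomena.SAWScalingLimit.Cruxes.Rigidity.Birth
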